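import Summits.ABC.IUTFork.Cor312ProvKIdeles
import Literature.IUT.LogVolume.GenuineLogThetaPoint
import HarnessLib

/-!
# Branch C certificate v5-L (`abc_of_licence_v5K`, p435505): its family-level SIDE binders are JOINTLY SATISFIABLE —
# a kernel non-vacuity record (RQ7 second-reader probe)

PROOF-ONLY record (no `def`, no new `Prop`) of the abc-iut cell, seat abc-iut-w6-d110 (gen 2; block C / W6), written as the KERNEL
PROBE of an RQ7 second read of `Conditional/AbcOfSGenuineKLicence.lean` (abc-iut-C-cert-3, p435505 = v5-L, the LICENCE form of the
`K`-level certificate v5 p434856). TAKES NO SIDE on [IUTchIII] Cor. 3.12 or on any author; the licence is an assumption label.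

THE POINT. The apex `abc_of_licence_v5K` binds, per `λ`-line datum `(P, l, T)`, Θ-ideles `t P l T` and q-ideles `tq P l T` in the
rescaled completions of `T.K` at the CONSTRUCTED pilot datum `Cor312Prov.pilotDataOfK T.D T.K`, subject to the five SIDE families
`htq0`, `htq1`, `ht0`, `ht1`, `htq` (non-zero; units off `S`; the q-ideles REALISE `P_q`). abc-iut-C-cert-3 proved the PER-DATUM
witness (`GenuineK.sideConditions_satisfiable_K`, p434856, from `Cor312Prov.twoMulLDvdOrdq_pilotDataOfK`, p434704 — [IUTchI] Ex. 3.2 (iv)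
as a theorem of the typed `K`). This file records the FAMILY-LEVEL form, in the apex's own binder types (copied byte for byte from
p435505): there EXIST families `t`, `tq` over ALL data meeting all five SIDE families at once (`licence_v5K_sideConditions_satisfiable`,
by choice over the per-datum witnesses). So — in contrast with the (U)-line genuine certificates v3/v4/Shrink2/Shrink3 (SIDE class
UNSATISFIABLE as typed, abc-iut-C-cert-3 F1 p432420) and the (P)-line genuine certificate p432966 (`abc_of_S_perImage_genuine_sideConditions_false`,
p435435) — the v5-L apex is NOT vacuous on its SIDE class: what it asks beyond inhabited data is exactly [LIC] `hLic` (the (xi-f) licence,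
the adjudication object), [READ] `hΘ` (one-sided Θ-volume identification, OPEN) and [CONE] `hreg` (hull estimate off the slot-constant
regime, VERDICT RISK ¶7). Nothing is said about the joint satisfiability of THOSE three.

HONEST FRAMING: locates / conditionally verifies; an existence statement about OUR binders over `K`; nothing here bears on
`−|log(Θ)|` versus `−|log(q)|`, on Cor. 3.12, or on abc; typed ≠ proved; instantiated ≠ endorsed; audited ≠ endorsed.
[cite: Mochizuki2012, IUTchI Def. 3.1 (b),(c) pp. 61–62, Ex. 3.2 (iv) p. 71] [cite: DupuyHilado2025, §3.3–§3.4] [claim: Mochizuki2012, status: disputed]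
-/

noncomputable section

open Set Function NumberField IsDedekindDomain

namespace Summit.ABC.IUTFork.Conditional

open Thm311 Thm311.Real Cor312 Cor312Vol Cor312Prov Literature.IUT.LogThetaLattice Literature.IUT.LogVolume
  Literature.IUT.HodgeTheaters Literature.IUT.LogVolume.ThetaData
open Literature.NumberTheory.DiophantineGeometry.GenEll

/-- **The family-level SIDE binders of `abc_of_licence_v5K` (p435505) are jointly satisfiable.** There exist, for every `λ`-line point
`P`, prime `l` and genuine Θ-volume datum `T : Cor22.ThetaVolumeDatumAt P l`, Θ-ideles `t P l T` and q-ideles `tq P l T` in the rescaled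
completions of `T.K` at `Cor312Prov.pilotDataOfK T.D T.K` such that ALL FIVE side families of the apex hold: `htq0` (q-ideles non-zero),
`htq1` (units off `S`), `ht0`, `ht1` (the same for the Θ-ideles), `htq` (the q-ideles REALISE `P_q` in Dupuy–Hilado's normalisation (3.4)) —
binder types copied byte for byte from p435505. Proof: choice over abc-iut-C-cert-3's per-datum existence theorems `Cor312Prov.exists_realising_qIdeles_pilotDataOfK` /
`Cor312Prov.exists_realising_thetaIdeles_pilotDataOfK` (p434704; [IUTchI] Ex. 3.2 (iv) for the typed `K`, `twoMulLDvdOrdq_pilotDataOfK`) — the same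
inputs as v5's per-datum witness `GenuineK.sideConditions_satisfiable_K` (p434856). CONSEQUENCE: the v5-L apex is NOT
vacuous on its SIDE class (contrast: v3/v4 p432420, (P)-genuine p435435); its content beyond inhabited data is `hLic` + `hΘ` + `hreg`, about
whose joint satisfiability nothing is claimed. No side taken on [IUTchIII] Cor. 3.12 or any author; typed ≠ proved.
[cite: Mochizuki2012, IUTchI Ex. 3.2 (iv) p. 71] [cite: DupuyHilado2025, §3.4] -/
theorem licence_v5K_sideConditions_satisfiable :
    ∃ (t : ∀ (P : NFPoint) (l : ℕ) (T : Cor22.ThetaVolumeDatumAt P l), letI := T.instFieldF; letI := T.instNumberFieldF; letI := T.instAlgebraF; letI := T.instFieldK;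
          letI := T.instNumberFieldK; letI := T.instAlgebraK; letI := T.instFieldFbar; letI := T.instAlgebraFbar;
          letI := T.instAlgebraKFbar; letI := T.instIsElliptic;
        ∀ (pp : Nat.Primes) (_ : Fin (pilotDataOfK T.D T.K).lstar) (x : (thetaIndex (pilotDataOfK T.D T.K)).Fibre (.inr pp)), haveI : Fact (pp : ℕ).Prime := ⟨pp.2⟩; kOf (pilotDataOfK T.D T.K) pp.1 x)
      (tq : ∀ (P : NFPoint) (l : ℕ) (T : Cor22.ThetaVolumeDatumAt P l), letI := T.instFieldF; letI := T.instNumberFieldF; letI := T.instAlgebraF; letI := T.instFieldK;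
          letI := T.instNumberFieldK; letI := T.instAlgebraK; letI := T.instFieldFbar; letI := T.instAlgebraFbar;
          letI := T.instAlgebraKFbar; letI := T.instIsElliptic;
        ∀ (pp : Nat.Primes) (x : (thetaIndex (pilotDataOfK T.D T.K)).Fibre (.inr pp)), haveI : Fact (pp : ℕ).Prime := ⟨pp.2⟩; kOf (pilotDataOfK T.D T.K) pp.1 x),
      -- htq0
      (∀ P l T pp x, tq P l T pp x ≠ 0) ∧
      -- htq1
      (∀ (P : NFPoint) (l : ℕ) (T : Cor22.ThetaVolumeDatumAt P l), letI := T.instFieldF; letI := T.instNumberFieldF; letI := T.instAlgebraF; letI := T.instFieldK;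
          letI := T.instNumberFieldK; letI := T.instAlgebraK; letI := T.instFieldFbar; letI := T.instAlgebraFbar;
          letI := T.instAlgebraKFbar; letI := T.instIsElliptic;
        ∀ (pp : Nat.Primes) (x : (thetaIndex (pilotDataOfK T.D T.K)).Fibre (.inr pp)),
          haveI : Fact (pp : ℕ).Prime := ⟨pp.2⟩; placeOf (pilotDataOfK T.D T.K) pp.1 x ∉ (pilotDataOfK T.D T.K).S → ‖tq P l T pp x‖ = 1) ∧
      -- ht0
      (∀ P l T pp i x, t P l T pp i x ≠ 0) ∧
      -- ht1
      (∀ (P : NFPoint) (l : ℕ) (T : Cor22.ThetaVolumeDatumAt P l), letI := T.instFieldF; letI := T.instNumberFieldF; letI := T.instAlgebraF; letI := T.instFieldK;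
          letI := T.instNumberFieldK; letI := T.instAlgebraK; letI := T.instFieldFbar; letI := T.instAlgebraFbar;
          letI := T.instAlgebraKFbar; letI := T.instIsElliptic;
        ∀ (pp : Nat.Primes) (i : Fin (pilotDataOfK T.D T.K).lstar) (x : (thetaIndex (pilotDataOfK T.D T.K)).Fibre (.inr pp)),
          haveI : Fact (pp : ℕ).Prime := ⟨pp.2⟩; placeOf (pilotDataOfK T.D T.K) pp.1 x ∉ (pilotDataOfK T.D T.K).S → ‖t P l T pp i x‖ = 1) ∧
      -- htq
      (∀ (P : NFPoint) (l : ℕ) (T : Cor22.ThetaVolumeDatumAt P l), letI := T.instFieldF; letI := T.instNumberFieldF; letI := T.instAlgebraF; letI := T.instFieldK;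
          letI := T.instNumberFieldK; letI := T.instAlgebraK; letI := T.instFieldFbar; letI := T.instAlgebraFbar;
          letI := T.instAlgebraKFbar; letI := T.instIsElliptic;
        ∀ (pp : Nat.Primes) (x : (thetaIndex (pilotDataOfK T.D T.K)).Fibre (.inr pp)),
          haveI : Fact (pp : ℕ).Prime := ⟨pp.2⟩
          Real.log ‖tq P l T pp x‖ = -((pilotDataOfK T.D T.K).qPilot (placeOf (pilotDataOfK T.D T.K) pp.1 x)) * logNorm T.K (placeOf (pilotDataOfK T.D T.K) pp.1 x) /
            localDegree T.K (placeOf (pilotDataOfK T.D T.K) pp.1 x)) := by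
  -- per datum, C-cert-3's existence theorems (p434704) under the datum's bundled instances; the Θ-realising clause is dropped (v5-L has no `ht`)
  have hW : ∀ (P : NFPoint) (l : ℕ) (T : Cor22.ThetaVolumeDatumAt P l), letI := T.instFieldF; letI := T.instNumberFieldF; letI := T.instAlgebraF; letI := T.instFieldK;
      letI := T.instNumberFieldK; letI := T.instAlgebraK; letI := T.instFieldFbar; letI := T.instAlgebraFbar;
      letI := T.instAlgebraKFbar; letI := T.instIsElliptic;
      ∃ (tq : ∀ (pp : Nat.Primes) (x : (thetaIndex (pilotDataOfK T.D T.K)).Fibre (.inr pp)),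
          haveI : Fact (pp : ℕ).Prime := ⟨pp.2⟩; kOf (pilotDataOfK T.D T.K) pp.1 x)
        (t : ∀ (pp : Nat.Primes) (_ : Fin (pilotDataOfK T.D T.K).lstar) (x : (thetaIndex (pilotDataOfK T.D T.K)).Fibre (.inr pp)),
          haveI : Fact (pp : ℕ).Prime := ⟨pp.2⟩; kOf (pilotDataOfK T.D T.K) pp.1 x),
        (∀ pp x, tq pp x ≠ 0) ∧
        (∀ (pp : Nat.Primes) (x : (thetaIndex (pilotDataOfK T.D T.K)).Fibre (.inr pp)),
            haveI : Fact (pp : ℕ).Prime := ⟨pp.2⟩; placeOf (pilotDataOfK T.D T.K) pp.1 x ∉ (pilotDataOfK T.D T.K).S → ‖tq pp x‖ = 1) ∧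
        (∀ pp i x, t pp i x ≠ 0) ∧
        (∀ (pp : Nat.Primes) (i : Fin (pilotDataOfK T.D T.K).lstar) (x : (thetaIndex (pilotDataOfK T.D T.K)).Fibre (.inr pp)),
            haveI : Fact (pp : ℕ).Prime := ⟨pp.2⟩; placeOf (pilotDataOfK T.D T.K) pp.1 x ∉ (pilotDataOfK T.D T.K).S → ‖t pp i x‖ = 1) ∧
        (∀ (pp : Nat.Primes) (x : (thetaIndex (pilotDataOfK T.D T.K)).Fibre (.inr pp)),
            haveI : Fact (pp : ℕ).Prime := ⟨pp.2⟩
            Real.log ‖tq pp x‖ = -((pilotDataOfK T.D T.K).qPilot (placeOf (pilotDataOfK T.D T.K) pp.1 x)) *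
              logNorm T.K (placeOf (pilotDataOfK T.D T.K) pp.1 x) / localDegree T.K (placeOf (pilotDataOfK T.D T.K) pp.1 x)) :=
    fun P l T => by
      letI := T.instFieldF; letI := T.instNumberFieldF; letI := T.instAlgebraF; letI := T.instFieldK
      letI := T.instNumberFieldK; letI := T.instAlgebraK; letI := T.instFieldFbar; letI := T.instAlgebraFbar
      letI := T.instAlgebraKFbar; letI := T.instIsElliptic
      obtain ⟨tq, htq0, htq1, htq⟩ := Cor312Prov.exists_realising_qIdeles_pilotDataOfK T.D
      obtain ⟨t, ht0, ht1, -⟩ := Cor312Prov.exists_realising_thetaIdeles_pilotDataOfK T.D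
      exact ⟨tq, t, htq0, htq1, ht0, ht1, htq⟩
  -- choice over the data
  refine ⟨fun P l T => (hW P l T).choose_spec.choose, fun P l T => (hW P l T).choose, ?_, ?_, ?_, ?_, ?_⟩
  · exact fun P l T => (hW P l T).choose_spec.choose_spec.1
  · exact fun P l T => (hW P l T).choose_spec.choose_spec.2.1
  · exact fun P l T => (hW P l T).choose_spec.choose_spec.2.2.1
  · exact fun P l T => (hW P l T).choose_spec.choose_spec.2.2.2.1
  · exact fun P l T => (hW P l T).choose_spec.choose_spec.2.2.2.2

end Summit.ABC.IUTFork.Conditional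

end
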